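import Summits.NavierStokesRegularity.NavierStokesRegularity.Theorems.SoloRefuteGeurdes2017Sufficiency
import Literature.Analysis.FluidPDE.VorticityCalculus
import Literature.Analysis.FluidPDE.PeriodicGalileanNonuniqueness
import Literature.Analysis.FluidPDE.ClassicalSolutionGalilean
import HarnessLib

/-!
# Solo salvage for claim C106 `Geurdes2017` (cell `ns-claims`, D-0090): the TRUE steps of the
# printed chain for the GENERAL classes 𝒰 / 𝒰″, and the positive form of the locator

Text of record: H. Geurdes, Cogent Mathematics 4 (2017) 1284293 ≡ arXiv:1703.05113 v1 (9 pp.);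
typed skeleton `Literature.Claims.NS.Geurdes2017` (typist-3 g2, p473176). ADJUDICATED #35: first
failing step `Step3a_stationaryCriterion` (§2.5 (2.19) p.6), false lemma by
`…Theorems.Geurdes2017.not_Step3a_stationaryCriterion` (refuter-5, p476475); downstream
`Step6_vhSufficiency` false by `not_Step6_vhSufficiency` (p478771).

This file records what is TRUE in the chain, as kernel theorems over the skeleton's own decls:

* `hasRapidTimeDecay_const_iff` — **the positive form of the locator**, for any normed spaces:
  a STATIONARY force `(t,x) ↦ g(x)` satisfies Fefferman's time-decay clause (9)
  (`HasRapidTimeDecay`) iff `g = 0`; hence `forceClass_const_iff` (a stationary force is in the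
  paper's class 𝒢 (2.2) iff it vanishes) and `forceClass_fcrl_iff` (the paper's witness force
  `f^crl` (2.18) is admissible iff `∇×u⁰ + 𝒟_{c,ν}u⁰ ≡ 0`). Reusable for every (D)-direction
  argument that feeds a time-independent force into Fefferman's class.
* `step1_holds` — Step 1 (§2.3 (2.5)–(2.8) p.4–5): for `u⁰ ∈ 𝒰`, `c ≠ 0`, `h ≥ 0` the ansatz
  `v^h` has `v^h(·,0) ≠ u⁰`, `∇·v^h(·,h) ≡ 3`, and is not periodic at all `t ≥ 0`.
* `step2_holds` — Step 2 ((2.9)–(2.17) p.5–6): the NS operator of `v^h` at `t = h` equals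
  `(c + x) + 𝒟_{c,ν}u⁰(x)` for EVERY `u⁰ ∈ 𝒰` (refuter-5's `derivWithin_vh_U` did the datum `U`).
* `step4_holds` — Step 4 (§2.6 p.6): `𝒰″ ≠ ∅` (witness refuter-5's `dataSubclass_U`).
* `step5a_holds` — Step 5a ((2.22)–(2.23) p.7): no `C²` scalar has gradient `∇×u⁰ − (c + x)` when
  `∇×∇×u⁰ ≢ 0` (curl of a gradient vanishes).
* `step5_holds` — Step 5 (p.7 ¶3): for EVERY `u⁰ ∈ 𝒰″`, `c`, `h ≥ 0`, `ν`, the ansatz `v^h`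
  admits no smooth pressure at `t = h` (= Step 2 + Step 5a, exactly as printed).
* `step3b_holds` (rev 2) — Step 3b ((2.20) p.6): the slice `f^crl(·,0)` of a smooth periodic `u⁰` is
  smooth, `ℤ³`-periodic, with bounded derivatives of every order (derivatives of periodic fields are
  periodic; periodic continuous fields are bounded).

So every typed step other than the locator pair 3a/3 and the quantifier passage 6 is kernel-true
(rev 2 adds 3b, completing the list 1, 2, 3b, 4, 5a, 5);
the argument's content is a correct computation about ONE trial field that is not a solution
candidate (Δ8). Nothing here asserts a step of the claim beyond these theorems. Salvage seat
ns-claims-salvage-p5 g3. Solo lane (`Theorems/SoloSalvage<Slug>.lean`, no item).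

WHAT THIS IS NOT: not a claim about NS regularity or blow-up; not a claim about any author beyond the
typed locator.
-/

-- lint debt (one line): the Theorems namespace repeats the summit name by the D-0017 layout
-- (single-conjunct summit), as in every sibling Solo file.
set_option linter.dupNamespace false

noncomputable section

open Set Real Function
open scoped ContDiff Laplacian

namespace Summit.NavierStokesRegularity.NavierStokesRegularity.Theorems.Geurdes2017Salvage

open Literature.Analysis.FluidPDE
open Literature.Claims.NS.Geurdes2017
open Summit.NavierStokesRegularity.NavierStokesRegularity.Theorems.Geurdes2017

/-! ### The positive form of the locator: a stationary force decays in time iff it vanishes -/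

section Stationary

variable {E : Type*} [NormedAddCommGroup E] [InnerProductSpace ℝ E]
  {F : Type*} [NormedAddCommGroup F] [NormedSpace ℝ F]

/-- **A stationary force satisfies Fefferman's time-decay condition (9) iff it is identically zero.**
For `f(t,x) = g(x)`, the clause `(1+t)^K ‖∂^n f(t,x)‖ ≤ C_{n,K}` for all `t ≥ 0` (all `n`, `K`)
already fails at `n = 0`, `K = 1` at any point where `g ≠ 0` (let `t → ∞`); conversely the zero
force has all derivatives zero. This is the content behind the C106 locator («(9) for stationary
force is (2.19); the constant K is no longer of importance», §2.5 p.6): the decay exponent is what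
excludes every non-zero time-independent force from the class of (D).
[cite: Geurdes2017, eq. (2.2) p.3 with eq. (2.19) p.6] -/
theorem hasRapidTimeDecay_const_iff (g : E → F) :
    HasRapidTimeDecay (fun _ : ℝ => g) ↔ g = 0 := by
  constructor
  · intro h
    funext x
    by_contra hx
    have hpos : 0 < ‖g x‖ := norm_pos_iff.2 hx
    obtain ⟨C, hC⟩ := h 0 1
    have h1 := hC (|C| / ‖g x‖) (by positivity) x
    rw [pow_one, norm_iteratedFDerivWithin_zero] at h1
    change (1 + |C| / ‖g x‖) * ‖g x‖ ≤ C at h1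
    rw [add_mul, one_mul, div_mul_cancel₀ _ hpos.ne'] at h1
    linarith [le_abs_self C]
  · rintro rfl
    intro n K
    refine ⟨0, fun t _ x => ?_⟩
    have h0 : Function.uncurry (fun _ : ℝ => (0 : E → F)) = 0 := rfl
    rw [h0, iteratedFDerivWithin_zero, Pi.zero_apply, norm_zero, mul_zero]

end Stationary

/-- **A stationary force lies in the paper's class 𝒢 (2.2) — smooth on the half-space, `ℤ³`-periodic
for `t ≥ 0`, with Fefferman's decay (9) — iff it vanishes identically.**
[cite: Geurdes2017, eq. (2.2) p.3] -/
theorem forceClass_const_iff (g : EuclideanSpace ℝ (Fin 3) → EuclideanSpace ℝ (Fin 3)) :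
    forceClass (fun _ : ℝ => g) ↔ g = 0 := by
  refine ⟨fun h => (hasRapidTimeDecay_const_iff g).1 h.2.2, ?_⟩
  rintro rfl
  refine ⟨?_, fun t _ j x => rfl, (hasRapidTimeDecay_const_iff _).2 rfl⟩
  have h0 : Function.uncurry (fun _ : ℝ => (0 : EuclideanSpace ℝ (Fin 3) → EuclideanSpace ℝ (Fin 3))) =
      fun _ => 0 := rfl
  unfold IsSmoothOnHalfSpace
  rw [h0]
  exact contDiffOn_const

/-- **The paper's witness force `f^crl` (2.18) is admissible for (D) iff it vanishes identically**:
`f^crl ∈ 𝒢 ↔ (∇×u⁰ + 𝒟_{c,ν}u⁰ ≡ 0)` — for the data the paper names (e.g. the ABC field,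
`f^crl = (2π + 1 + 4π²ν)u⁰ + (c·∇)u⁰ ≢ 0`) the pair `(u⁰, f^crl)` is therefore outside Clay (D).
[cite: Geurdes2017, eq. (2.18) p.6 with eq. (2.2) p.3] -/
theorem forceClass_fcrl_iff (ν : ℝ) (c : EuclideanSpace ℝ (Fin 3))
    (u0 : EuclideanSpace ℝ (Fin 3) → EuclideanSpace ℝ (Fin 3)) :
    forceClass (fcrl ν c u0) ↔ (fun x => curl u0 x + dOp c ν u0 x) = 0 :=
  forceClass_const_iff _

/-! ### Step 4: the witness class 𝒰″ is non-empty -/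

/-- **Step 4 (§2.6 p.6) holds**: `𝒰″ ≠ ∅` — the 1-periodic ABC field `U = abc 0 1 1 (2π·)` is a
member (refuter-5's `dataSubclass_U`, p476475). [cite: Geurdes2017, §2.6 p.6] -/
theorem step4_holds : Step4_subclassNonempty := ⟨U, dataSubclass_U⟩

/-! ### Step 5a: no gradient equals `∇×u⁰ − (c + x)` when `∇×∇×u⁰ ≢ 0` -/

/-- **Step 5a ((2.22)–(2.23) p.7) holds**: if `u⁰` is smooth with `∇×∇×u⁰(x₀) ≠ 0`, no `C²` scalar
`q` has `∇q = ∇×u⁰ − (c + ·)`: taking the curl, `0 = ∇×∇q = ∇×∇×u⁰ − ∇×(c + ·) = ∇×∇×u⁰`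
at `x₀`. [cite: Geurdes2017, eqs. (2.22)–(2.23) p.7] -/
theorem step5a_holds : Step5a_noGradient := by
  rintro u0 hu0 ⟨x₀, hx₀⟩ c ⟨q, hq, hgrad⟩
  have hcurl0 : curl (gradient q) x₀ = 0 := curl_gradient_eq_zero_holds q hq x₀
  have hfun : gradient q = fun x => curl u0 x - (c + x) := funext hgrad
  have hcu : DifferentiableAt ℝ (curl u0) x₀ :=
    ((contDiff_curl (n := 1) (hu0.of_le (by exact_mod_cast le_top))).differentiable
      one_ne_zero).differentiableAt
  have hcx : DifferentiableAt ℝ (fun y : EuclideanSpace ℝ (Fin 3) => c + y) x₀ :=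
    differentiableAt_id.const_add c
  rw [hfun, curl_sub hcu hcx, curl_const_add_self, sub_zero] at hcurl0
  exact hx₀ hcurl0

/-! ### Step 2: the NS operator of the ansatz `v^h` at `t = h`, for every `u⁰ ∈ 𝒰` -/

/-- `∂ₛ v^h(x,s)|_{s=h} = −Du⁰(x)(x + u⁰(x))` for any differentiable `u⁰` (one-sided derivative
within `[0,∞)` at `h ≥ 0`; (2.9)–(2.10) p.5: `∂ₜξ^h = −(x + u⁰)`, `ξ^h(x,h) = x`).
[cite: Geurdes2017, eqs. (2.9)–(2.10) p.5] -/
theorem derivWithin_vh {u0 : EuclideanSpace ℝ (Fin 3) → EuclideanSpace ℝ (Fin 3)}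
    (hu0 : Differentiable ℝ u0) (c : EuclideanSpace ℝ (Fin 3)) {h : ℝ} (hh : 0 ≤ h)
    (x : EuclideanSpace ℝ (Fin 3)) :
    derivWithin (fun s => vh u0 c h s x) (Ici 0) h = -(fderiv ℝ u0 x (x + u0 x)) := by
  have hin : HasDerivAt (fun s : ℝ => x - (s - h) • (x + u0 x)) (-((1 : ℝ) • (x + u0 x))) h :=
    (((hasDerivAt_id h).sub_const h).smul_const (x + u0 x)).const_sub x
  have hx : x - (h - h) • (x + u0 x) = x := by simp
  have hU' : HasFDerivAt u0 (fderiv ℝ u0 x) (x - (h - h) • (x + u0 x)) := by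
    rw [hx]; exact (hu0 x).hasFDerivAt
  have hcomp : HasDerivAt (fun s => vh u0 c h s x) (fderiv ℝ u0 x (-((1 : ℝ) • (x + u0 x)))) h :=
    (hU'.comp_hasDerivAt h hin).const_add (c + x)
  rw [one_smul, map_neg] at hcomp
  exact hcomp.hasDerivWithinAt.derivWithin (uniqueDiffOn_Ici 0 h (mem_Ici.2 hh))

/-- The slice `v^h(·,h)` is the function `y ↦ c + y + u⁰(y)`. [cite: Geurdes2017, eq. (2.5) p.4] -/
theorem vh_self_eq (u0 : EuclideanSpace ℝ (Fin 3) → EuclideanSpace ℝ (Fin 3))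
    (c : EuclideanSpace ℝ (Fin 3)) (h : ℝ) : vh u0 c h h = fun y => c + y + u0 y :=
  funext fun y => vh_self u0 c h y

/-- `D(v^h(·,h))(x) = id + Du⁰(x)` ((2.13) p.5). [cite: Geurdes2017, eq. (2.13) p.5] -/
theorem fderiv_vh_self {u0 : EuclideanSpace ℝ (Fin 3) → EuclideanSpace ℝ (Fin 3)}
    {x : EuclideanSpace ℝ (Fin 3)} (hu0 : DifferentiableAt ℝ u0 x) (c : EuclideanSpace ℝ (Fin 3))
    (h : ℝ) : fderiv ℝ (vh u0 c h h) x = ContinuousLinearMap.id ℝ _ + fderiv ℝ u0 x := by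
  rw [vh_self_eq]
  exact (((hasFDerivAt_id x).const_add c).add hu0.hasFDerivAt).fderiv

/-- `Δ(v^h(·,h))(x) = Δu⁰(x)` ((2.15) p.5: the affine part is harmonic).
[cite: Geurdes2017, eq. (2.15) p.5] -/
theorem laplacian_vh_self {u0 : EuclideanSpace ℝ (Fin 3) → EuclideanSpace ℝ (Fin 3)}
    (hu0 : ContDiff ℝ 2 u0) (c : EuclideanSpace ℝ (Fin 3)) (h : ℝ) (x : EuclideanSpace ℝ (Fin 3)) :
    Δ (vh u0 c h h) x = Δ u0 x := by
  have ha : ContDiffAt ℝ 2 (fun y : EuclideanSpace ℝ (Fin 3) => c + y) x :=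
    (contDiff_const.add contDiff_id).contDiffAt
  have hfu : vh u0 c h h = (fun y : EuclideanSpace ℝ (Fin 3) => c + y) + u0 := by
    funext y; rw [vh_self]; rfl
  rw [hfu, ha.laplacian_add hu0.contDiffAt, laplacian_const_add_self, zero_add]

/-- **Step 2 ((2.9)–(2.17) p.5–6) holds for every `u⁰ ∈ 𝒰`**:
`(∂ₜv^h + (v^h·∇)v^h − νΔv^h)|_{t=h} = (c + x) + 𝒟_{c,ν}u⁰(x)` — the terms `∓Du⁰(x)(x + u⁰(x))`
from (2.12) and (2.14) cancel, leaving `c + x + u⁰ + Du⁰(x)c − νΔu⁰`.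
[cite: Geurdes2017, eqs. (2.12)–(2.17) p.5–6] -/
theorem step2_holds : Step2_operatorAtH := by
  intro ν u0 hu0 c h hh x
  obtain ⟨hsm, -, -⟩ := hu0
  have hd : Differentiable ℝ u0 := hsm.differentiable (by simp)
  have h2 : ContDiff ℝ 2 u0 := contDiff_infty.1 hsm 2
  rw [derivWithin_vh hd c hh, fderiv_vh_self (hd x) c h, laplacian_vh_self h2 c h x, vh_self]
  simp only [_root_.add_apply, ContinuousLinearMap.id_apply, map_add, dOp]
  abel

/-! ### Step 5: the ansatz admits no pressure at `t = h`, for every `u⁰ ∈ 𝒰″` -/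

/-- **Step 5 (p.7 ¶3) holds for every `ν`, `c`, `u⁰ ∈ 𝒰″`, `h ≥ 0`**: there is no smooth pressure
`p` on the half-space with which `v^h` satisfies the momentum equation (1.1) with force `f^crl` at
`t = h`. By Step 2 such a `p` would have `∇p(h,·) = ∇×u⁰ − (c + ·)` ((2.22)), which Step 5a
excludes since `∇×∇×u⁰ ≢ 0` for `u⁰ ∈ 𝒰″` ((2.23)). (This is a correct statement about the trial
field `v^h`, which is not a solution candidate: `∇·v^h(·,h) = 3`, Step 1.)
[cite: Geurdes2017, p.7 ¶3 with eqs. (2.17), (2.22)–(2.23)] -/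
theorem step5_holds : Step5_noPressure := by
  intro ν _hν c _hc u0 hu0 h hh
  rintro ⟨p, hp, hmom⟩
  obtain ⟨hU, -, -, hcc, -⟩ := hu0
  have hsm : ContDiff ℝ ∞ u0 := hU.1
  have hp' : IsSmoothSpaceTimeOn (Ici 0) p := hp
  have hp2 : ContDiff ℝ 2 (p h) := contDiff_infty.1 (hp'.contDiff_slice (mem_Ici.2 hh)) 2
  have hstep2 := step2_holds ν u0 hU c h hh
  have hgrad : ∀ x, gradient (p h) x = curl u0 x - (c + x) := by
    intro x
    have e := hmom x
    have s := hstep2 x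
    have hg : gradient (p h) x =
        ν • Δ (vh u0 c h h) x + fcrl ν c u0 h x -
          (derivWithin (fun s => vh u0 c h s x) (Ici 0) h +
            fderiv ℝ (vh u0 c h h) x (vh u0 c h h x)) := by
      rw [e]; abel
    have hs : derivWithin (fun s => vh u0 c h s x) (Ici 0) h +
        fderiv ℝ (vh u0 c h h) x (vh u0 c h h x) =
          (c + x) + dOp c ν u0 x + ν • Δ (vh u0 c h h) x := by
      rw [← s]; abel
    rw [hg, hs, fcrl_apply, laplacian_vh_self (contDiff_infty.1 hsm 2) c h x, dOp]
    abel
  exact step5a_holds u0 hsm hcc c ⟨p h, hp2, hgrad⟩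

/-! ### Step 1: what the ansatz violates (context step, §2.3) -/

/-- **Step 1 (§2.3 (2.5)–(2.8) p.4–5) holds**: for `u⁰ ∈ 𝒰`, `c ≠ 0`, `h ≥ 0`:
(i) `v^h(·,0) ≠ u⁰` — `v^h(x,0) − u⁰(x) = c + x + (u⁰(ξ) − u⁰(x))` is unbounded in `x` while a
continuous periodic `u⁰` is bounded; (ii) `∇·v^h(·,h) = ∇·(c + x + u⁰) = 3 + 0`;
(iii) `v^h(·,h) = c + x + u⁰(x)` is not `ℤ³`-periodic (`x ↦ x` is not). (The paper reads these as
«breakdown as required in (D)»; as statements about `v^h` they are true.)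
[cite: Geurdes2017, §2.3 eqs. (2.5)–(2.8) p.4–5] -/
theorem step1_holds : Step1_vhViolates := by
  intro u0 hu0 c _hc h hh
  obtain ⟨hsm, hdiv, hper⟩ := hu0
  refine ⟨?_, ?_, ?_⟩
  · intro heq
    obtain ⟨C, hC⟩ := IsLatticePeriodic.exists_forall_norm_le hper hsm.continuous
    set x : EuclideanSpace ℝ (Fin 3) := (2 * C + ‖c‖ + 1) • EuclideanSpace.single 0 1 with hxdef
    have hx := congrFun heq x
    have hvh : vh u0 c h 0 x = c + x + u0 (xi u0 h 0 x) := rfl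
    rw [hvh] at hx
    have hxeq : x = u0 x - u0 (xi u0 h 0 x) - c := by rw [← hx]; abel
    have hle : ‖x‖ ≤ 2 * C + ‖c‖ := by
      have h1 := norm_sub_le (u0 x - u0 (xi u0 h 0 x)) c
      have h2 := norm_sub_le (u0 x) (u0 (xi u0 h 0 x))
      have h3 := hC x
      have h4 := hC (xi u0 h 0 x)
      rw [← hxeq] at h1
      linarith
    have hn1 : ‖(EuclideanSpace.single 0 (1 : ℝ) : EuclideanSpace ℝ (Fin 3))‖ = 1 := by simp
    have hnorm : ‖x‖ = |2 * C + ‖c‖ + 1| := by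
      rw [hxdef, norm_smul, hn1, mul_one, Real.norm_eq_abs]
    rw [hnorm] at hle
    linarith [le_abs_self (2 * C + ‖c‖ + 1)]
  · intro x
    have hd : DifferentiableAt ℝ u0 x := (hsm.differentiable (by simp)) x
    unfold NSWave0.divergence
    rw [fderiv_vh_self hd c h]
    have hdx := hdiv x
    unfold NSWave0.divergence at hdx
    rw [ContinuousLinearMap.toLinearMap_add, map_add, hdx, add_zero, ContinuousLinearMap.coe_id,
      LinearMap.trace_id, finrank_euclideanSpace_fin]
    norm_num
  · intro hall
    have h1 := hall h hh 0 0
    rw [vh_self, vh_self, hper 0 0, zero_add] at h1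
    -- `h1 : c + e₀ + u⁰ 0 = c + 0 + u⁰ 0`
    have h2 : (EuclideanSpace.single 0 1 : EuclideanSpace ℝ (Fin 3)) = 0 :=
      add_left_cancel (add_right_cancel h1)
    have h3 := congrArg (fun v : EuclideanSpace ℝ (Fin 3) => v 0) h2
    simp at h3

/-! ### Step 3b: the slice `f^crl(·,0)` is smooth, periodic, with bounded derivatives -/

/-- Translation invariance of the derivative of a `ℤ³`-periodic field: `Du⁰(x + eⱼ) = Du⁰(x)`.
[folklore] -/
theorem fderiv_periodic {F : Type*} [NormedAddCommGroup F] [NormedSpace ℝ F]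
    {g : EuclideanSpace ℝ (Fin 3) → F} (hper : IsLatticePeriodic g) (j : Fin 3)
    (x : EuclideanSpace ℝ (Fin 3)) :
    fderiv ℝ g (x + EuclideanSpace.single j 1) = fderiv ℝ g x := by
  have hfun : (fun y => g (y + EuclideanSpace.single j 1)) = g := funext fun y => hper j y
  rw [← fderiv_comp_add_right, hfun]

/-- Every iterated derivative of a `ℤ³`-periodic field is `ℤ³`-periodic. [folklore] -/
theorem iteratedFDeriv_periodic {F : Type*} [NormedAddCommGroup F] [NormedSpace ℝ F]
    {g : EuclideanSpace ℝ (Fin 3) → F} (hper : IsLatticePeriodic g) (n : ℕ) :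
    IsLatticePeriodic (iteratedFDeriv ℝ n g) := by
  intro j x
  have hfun : (fun y => g (y + EuclideanSpace.single j 1)) = g := funext fun y => hper j y
  rw [← iteratedFDeriv_comp_add_right, hfun]

/-- A smooth `ℤ³`-periodic field has bounded derivatives of every order (each iterated derivative is
periodic and continuous, hence bounded). [folklore] -/
theorem bounded_iteratedFDeriv_of_periodic {F : Type*} [NormedAddCommGroup F] [NormedSpace ℝ F]
    {g : EuclideanSpace ℝ (Fin 3) → F} (hg : ContDiff ℝ ∞ g) (hper : IsLatticePeriodic g) (n : ℕ) :
    ∃ C : ℝ, ∀ x, ‖iteratedFDeriv ℝ n g x‖ ≤ C :=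
  IsLatticePeriodic.exists_forall_norm_le (iteratedFDeriv_periodic hper n)
    (hg.continuous_iteratedFDeriv (by exact_mod_cast le_top))

/-- The slice `f^crl(·,0) = ∇×u⁰ + u⁰ + Du⁰(·)c − νΔu⁰` is smooth for smooth `u⁰`.
[cite: Geurdes2017, eqs. (2.17)–(2.18) p.6] -/
theorem contDiff_fcrl_slice {u0 : EuclideanSpace ℝ (Fin 3) → EuclideanSpace ℝ (Fin 3)}
    (hu0 : ContDiff ℝ ∞ u0) (ν : ℝ) (c : EuclideanSpace ℝ (Fin 3)) :
    ContDiff ℝ ∞ (fcrl ν c u0 0) := by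
  have hcurl : ContDiff ℝ ∞ (curl u0) :=
    contDiff_curl (n := ⊤) (hu0.of_le (by exact_mod_cast le_top))
  have hD : ContDiff ℝ ∞ (fun x => fderiv ℝ u0 x c) :=
    (hu0.fderiv_right (m := ∞) (by exact_mod_cast le_top)).clm_apply contDiff_const
  have hL : ContDiff ℝ ∞ (Δ u0) := by
    rw [InnerProductSpace.laplacian_eq_iteratedFDeriv_stdOrthonormalBasis]
    refine ContDiff.sum fun i _ => ?_
    have h2 : ContDiff ℝ ∞ (iteratedFDeriv ℝ 2 u0) :=
      hu0.iteratedFDeriv_right (m := ∞) (i := 2) (by norm_cast)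
    exact (ContinuousMultilinearMap.apply ℝ (fun _ : Fin 2 => EuclideanSpace ℝ (Fin 3))
      (EuclideanSpace ℝ (Fin 3)) ![stdOrthonormalBasis ℝ _ i, stdOrthonormalBasis ℝ _ i]).contDiff.comp h2
  have h : fcrl ν c u0 0 = fun x => curl u0 x + (u0 x + fderiv ℝ u0 x c - ν • (Δ u0) x) :=
    funext fun x => fcrl_apply ν c u0 0 x
  rw [h]
  exact hcurl.add ((hu0.add hD).sub (hL.const_smul ν))

/-- The slice `f^crl(·,0)` of a `ℤ³`-periodic smooth `u⁰` is `ℤ³`-periodic (derivatives of periodic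
fields are periodic). [cite: Geurdes2017, §2.6 p.6 «f^crl(x + eⱼ) = f^crl(x)»] -/
theorem periodic_fcrl_slice {u0 : EuclideanSpace ℝ (Fin 3) → EuclideanSpace ℝ (Fin 3)}
    (hper : IsLatticePeriodic u0) (ν : ℝ) (c : EuclideanSpace ℝ (Fin 3)) :
    IsLatticePeriodic (fcrl ν c u0 0) := by
  intro j x
  rw [fcrl_apply, fcrl_apply, curl_eq_curlCLM, curl_eq_curlCLM, fderiv_periodic hper j x, hper j x]
  have hfun : (fun y => u0 (y + EuclideanSpace.single j 1)) = u0 := funext fun y => hper j y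
  have hL : (Δ u0) (x + EuclideanSpace.single j 1) = (Δ u0) x := by
    rw [← laplacian_comp_add_right u0 (EuclideanSpace.single j 1) x, hfun]
  rw [hL]

/-- **Step 3b ((2.20) p.6) holds**: for `u⁰ ∈ 𝒰″` (indeed for every smooth periodic `u⁰`) the slice
`f^crl(·,0)` is smooth, `ℤ³`-periodic and has bounded derivatives of every order ((2.19)).
[cite: Geurdes2017, §2.5–§2.6 eqs. (2.18)–(2.20) p.6] -/
theorem step3b_holds : Step3b_fcrlRegular := by
  intro ν _hν c _hc u0 hu0
  obtain ⟨⟨hsm, -, hper⟩, -⟩ := hu0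
  exact ⟨contDiff_fcrl_slice hsm ν c, periodic_fcrl_slice hper ν c,
    bounded_iteratedFDeriv_of_periodic (contDiff_fcrl_slice hsm ν c) (periodic_fcrl_slice hper ν c)⟩

end Summit.NavierStokesRegularity.NavierStokesRegularity.Theorems.Geurdes2017Salvage
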